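import Summits.QuantumFields.YangMills.Theorems.BalabanUVNodesN11TkOpMeasurable

/-!
# DAG node N11 — THE OPERAND ROWS OF THE NO-EXPANSION 𝐓-STEP FROM ROWS ON THE TERM VALUES: the §2 operand `exp A_k(s)` is measurable on the multiscale
# configuration space as soon as the background map is measurable and the term values, READ AT THE EMBEDDED BACKGROUND, are measurable functions of the
# background (and, for the boundary terms, jointly of the fluctuation variables); and it is bounded as soon as the term values are

HEADER — WORK-UNIT METADATA.  Cell `pub-ymgap`, YM-PLAN Track A (HUMAN RULING D-0062), seat `pub-ymgap-dag-n11-d` (g10; R134 fan-out seat N11 [B14], strategy s2),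
route `BalabanUVNodes` rev 25, item K1⁷ `StabilityBAtRecordR13SepCoPH` = stmt-QuantumFields-20542 (helper, `--kind proof --supports 20542 --as helper`, count-neutral).
[III] = [Balaban1988Convergent].  Over 11b∕11c (`Sect2.actionDataOfTerms`, `action23_actionDataOfTerms`, `sect2Operand`), r11 (`B14.Eq225Concrete.smearedWilson ∕ E225 ∕
EjSub ∕ R230 ∕ B240`), `MissingProofs` (`measurable_plaqHol`), `RegularGaugeGroup.measurable_reTr`.

WHY THIS FILE.  The g10 specification (`…N11NoExpansionStepSpecification`) asks, per old branch, that the old operand `ω ↦ exp A_k(init s′)(S, A(ω))(U_k(𝐖(ω)))` be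
MEASURABLE on the multiscale configuration space (a def-T ∕ def-R row).  The tree has no measurable structure on the coefficient algebra `MatA N`, so «measurable term
values» cannot even be stated on `Sect2.CPair`; what CAN be stated — and is exactly what the operand needs — is measurability of the term values READ AT THE EMBEDDED
BACKGROUND `U ↦ 𝐄^{(j)}(X, ι U, z)` (a function on the gauge-field space, which is measurable), and of the background map `𝐖 ↦ U_k(𝐖)`.  This file proves the
reduction: those rows ⇒ the operand row (the Wilson part is measurable outright).

WHAT THIS FILE PROVES (0 `sorry`, 0 `def`).  §1 `measurable_smearedWilson`, `measurable_ite_const`.  §2 ★ `measurable_action23_of_termRows` (the (2.23) action of record is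
jointly measurable in (background field, fluctuation variables) from the three term rows).  §3 ★★ `measurable_sect2Operand_of_termRows` (the operand-measurable row of
the specification from the term rows and the measurability of the background map).  §4 `exists_bound_sum ∕ _ite ∕ _add ∕ _sub ∕ _const_mul`, `abs_smearedWilson_le`,
★ `exists_bound_action23_of_termBounds`, ★★ `exists_bound_sect2Operand_of_termBounds` (the operand-bounded row of the specification from uniform bounds on the term values —
the printed (2.27), (2.31), (2.41) are such bounds).

HONEST FRAMING.  Helper lane of K1⁷; kernel bookkeeping; nothing of Bałaban's is asserted; the term rows and the background-map row are DISPLAYED (def-T ∕ def-R).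
N11 NOT discharged; K1⁷ NOT closed; counts unmoved (typed 28∕28 · discharged 5∕27).  One finite four-torus programme at fixed `ε = L^{−K}` — NOT ℝ⁴, NOT OS, NOT a
mass gap, NOT Clay.  No `sorry`, `axiom`, `instance`, `notation`.
Sources (SHAPE only): [III] (2.18) p.257, (2.23)–(2.27) pp.258–259, (2.30) p.260, (2.40)–(2.41) p.261.
-/

noncomputable section

open MeasureTheory
open scoped BigOperators

namespace Summit.QuantumFields.YangMills.Theorems.BalabanUVNodesN11OperandRowsOfTermRows

open Literature.MathematicalPhysics.QuantumFieldTheory.Balaban1983to89 T4Continuum T4NestedCovariance Node00 Node00.Tk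
open B15DeterminingSets B14.Eq225Concrete

variable {F : T4Family} {N : ℕ} [NeZero N]

/-! ## §1  The smeared Wilson action is measurable; constant-guarded summands -/

/-- **`U ↦ A(φ, U)` IS MEASURABLE** on the scale-0 gauge fields of the torus (a finite sum of `φ(p)·(1 − Re tr U(∂p))`; `measurable_plaqHol`, `measurable_reTr`).
[cite: Balaban1988Convergent, (2.23)–(2.25) pp.258–259 (bookkeeping)] -/
theorem measurable_smearedWilson (K : ℕ) (w : Plaq (F.P K) 0 → ℝ) : Measurable (fun U : GaugeField (F.P K) 0 (SU N) => smearedWilson w U) := by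
  unfold smearedWilson
  refine Finset.measurable_sum _ fun p _ => ?_
  exact measurable_const.mul (measurable_const.sub ((RegularGaugeGroup.measurable_reTr (G := SU N)).comp (Missing.measurable_plaqHol p)))

/-- A summand guarded by a constant condition is measurable when its body is. [folklore] -/
theorem measurable_ite_const {α : Type*} [MeasurableSpace α] (c : Prop) [Decidable c] {f : α → ℝ} (hf : Measurable f) :
    Measurable (fun x => if c then f x else 0) := by
  by_cases hc : c
  · simp only [hc, if_true]; exact hf
  · simp only [hc, if_false]; exact measurable_const

/-! ## §2  ★ The (2.23) action of record is jointly measurable in (background field, fluctuation variables) from the term rows -/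

section Action

variable {V : Type} [MeasurableSpace V] {𝔸 : Type*} [NormedRing 𝔸] [NormedAlgebra ℂ 𝔸] [CompleteSpace 𝔸]

/-- **★ THE (2.23) ACTION OF RECORD IS JOINTLY MEASURABLE in the background field and the fluctuation variables**, for fixed `{S_i}`, from: (E-row) every
`U ↦ Re 𝐄^{(j)}(X, ι U, z)` measurable; (R-row) every `U ↦ Re 𝐑^{(j)}(X, ι U)` measurable; (B-row) every `(U, A) ↦ Re 𝐁^{(j)}(X, ι U, ({S_i}, A))` jointly measurable —
the term values read at the embedded background.  The Wilson parts are measurable outright (§1). [cite: Balaban1988Convergent, (2.23)–(2.25) pp.258–259, (2.30) p.260, (2.40) p.261] -/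
theorem measurable_action23_of_termRows (K : ℕ) (S : Sect2.Setting 𝔸 (SU N)) (Rz : Sect2.Residual (F.P K) 𝔸) (ν : Stage7Numerics) (M : ℕ) (g : ℕ → ℝ)
    (Ω Λ : ℕ → Set (Site (F.P K) 0)) (t : Sect2.TermValues (F.P K) 𝔸 V M) (k : ℕ) (S' : ℕ → Set (Site (F.P K) 0)) (Ek : ℝ)
    (hE : ∀ (j : ℕ) (X : (Sect2.domSys (F.P K) M j).Dom) (z : Site (F.P K) j) (g' : ℝ),
      Measurable (fun U : GaugeField (F.P K) 0 (SU N) => (t.E j X z g' (Sect2.ofBackgroundC S.ι U)).re))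
    (hR : ∀ (j : ℕ) (X : (Sect2.domSys (F.P K) M j).Dom), Measurable (fun U : GaugeField (F.P K) 0 (SU N) => (t.R j X (Sect2.ofBackgroundC S.ι U)).re))
    (hB : ∀ (j : ℕ) (X : (Sect2.domSys (F.P K) M j).Dom),
      Measurable (fun q : GaugeField (F.P K) 0 (SU N) × MSFluct (F.P K) V => (t.B j X (Sect2.ofBackgroundC S.ι q.1) (S', q.2)).re)) :
    Measurable (fun q : GaugeField (F.P K) 0 (SU N) × MSFluct (F.P K) V =>
      (Sect2.actionDataOfTerms S Rz ν M g Ω Λ t k (S', q.2) Ek).action23 k q.1) := by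
  simp only [Sect2.action23_actionDataOfTerms]
  refine Measurable.sub (Measurable.add (Measurable.add (Measurable.add ?_ ?_) ?_) ?_) measurable_const
  · -- the local Wilson term
    exact ((measurable_smearedWilson (N := N) K _).comp measurable_fst).neg
  · -- (2.25): the vacuum-subtracted E-terms and the counterterms
    unfold E225 EjSub
    refine Finset.measurable_sum _ fun j _ => Measurable.sub ?_ ?_
    · refine Finset.measurable_sum _ fun X _ => Finset.measurable_sum _ fun z _ => ?_
      exact measurable_ite_const _ (((hE j X z _).comp measurable_fst).sub measurable_const)
    · exact measurable_const.mul ((measurable_smearedWilson (N := N) K _).comp measurable_fst)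
  · -- (2.30): the R-terms
    unfold R230
    refine Finset.measurable_sum _ fun j _ => Finset.measurable_sum _ fun X _ => ?_
    exact measurable_ite_const _ (((hR j X).comp measurable_fst).sub measurable_const)
  · -- (2.40): the boundary terms, jointly in the fluctuation variables
    unfold B240
    refine Finset.measurable_sum _ fun j _ => Finset.measurable_sum _ fun X _ => ?_
    exact measurable_ite_const _ (hB j X)

end Action

/-! ## §3  ★★ The operand row of the specification from the term rows and the background-map row -/

section Operand

variable {V : Type} [MeasurableSpace V] {𝔸 : Type*} [NormedRing 𝔸] [NormedAlgebra ℂ 𝔸] [CompleteSpace 𝔸]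

/-- **★★ THE §2 OPERAND `ω ↦ exp A_k(s)(({S_i}, A(ω)), U_k(𝐖(ω)))` IS MEASURABLE ON THE MULTISCALE CONFIGURATION SPACE** from the three term rows of §2 and the
measurability of the background map `𝐖 ↦ U_k(𝐖)` (def-R's map of record at the history).  This is the «operand measurable» row of this seat's specification
`…N11NoExpansionStepSpecification` reduced to rows on the term values and the background. [cite: Balaban1988Convergent, (2.18) p.257, (2.23) p.258, (2.12) p.256] -/
theorem measurable_sect2Operand_of_termRows (K : ℕ) (S : Sect2.Setting 𝔸 (SU N)) (Rz : Sect2.Residual (F.P K) 𝔸) {ν : Stage7Numerics} {M : ℕ} {g : ℕ → ℝ}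
    {k : ℕ} (s : SeqOfRecord F ν M g K k) (t : Sect2.TermValues (F.P K) 𝔸 V M) (Ek : ℝ) {U : BgMap F N K} (hU : Measurable U)
    (S' : ℕ → Set (Site (F.P K) 0))
    (hE : ∀ (j : ℕ) (X : (Sect2.domSys (F.P K) M j).Dom) (z : Site (F.P K) j) (g' : ℝ),
      Measurable (fun U : GaugeField (F.P K) 0 (SU N) => (t.E j X z g' (Sect2.ofBackgroundC S.ι U)).re))
    (hR : ∀ (j : ℕ) (X : (Sect2.domSys (F.P K) M j).Dom), Measurable (fun U : GaugeField (F.P K) 0 (SU N) => (t.R j X (Sect2.ofBackgroundC S.ι U)).re))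
    (hB : ∀ (j : ℕ) (X : (Sect2.domSys (F.P K) M j).Dom),
      Measurable (fun q : GaugeField (F.P K) 0 (SU N) × MSFluct (F.P K) V => (t.B j X (Sect2.ofBackgroundC S.ι q.1) (S', q.2)).re)) :
    Measurable (fun ω : MultiCfg (F.P K) (SU N) V => sect2Operand F N V K S Rz s t Ek U (S', fun j => (ω j).2) (fun j => (ω j).1)) := by
  have hW : Measurable (fun ω : MultiCfg (F.P K) (SU N) V => U (fun j => (ω j).1)) :=
    hU.comp (measurable_pi_lambda _ fun j => measurable_fst.comp (measurable_pi_apply j))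
  have ha : Measurable (fun ω : MultiCfg (F.P K) (SU N) V => (fun j => (ω j).2 : MSFluct (F.P K) V)) :=
    measurable_pi_lambda _ fun j => measurable_snd.comp (measurable_pi_apply j)
  -- the action at `(({S_i}, A(ω)), U_k(𝐖(ω)))`, summand by summand (as in §2, composed with `hW`, `ha`)
  have hact : Measurable (fun ω : MultiCfg (F.P K) (SU N) V =>
      (Sect2.actionDataOfTerms S Rz ν M g s.Ω s.Λ t k (S', fun j => (ω j).2) Ek).action23 k (U (fun j => (ω j).1))) := by
    simp only [Sect2.action23_actionDataOfTerms]
    refine Measurable.sub (Measurable.add (Measurable.add (Measurable.add ?_ ?_) ?_) ?_) measurable_const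
    · exact ((measurable_smearedWilson (N := N) K _).comp hW).neg
    · unfold E225 EjSub
      refine Finset.measurable_sum _ fun j _ => Measurable.sub ?_ ?_
      · refine Finset.measurable_sum _ fun X _ => Finset.measurable_sum _ fun z _ => ?_
        exact measurable_ite_const _ (((hE j X z _).comp hW).sub measurable_const)
      · exact measurable_const.mul ((measurable_smearedWilson (N := N) K _).comp hW)
    · unfold R230
      refine Finset.measurable_sum _ fun j _ => Finset.measurable_sum _ fun X _ => ?_
      exact measurable_ite_const _ (((hR j X).comp hW).sub measurable_const)
    · unfold B240
      refine Finset.measurable_sum _ fun j _ => Finset.measurable_sum _ fun X _ => ?_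
      exact measurable_ite_const _ ((hB j X).comp (hW.prodMk ha))
  unfold sect2Operand sect2ActionDataOfRecord
  exact Real.measurable_exp.comp hact

end Operand

/-! ## §4  ★★ The operand BOUND of the specification from uniform bounds on the term values -/

section Bound

/-- Finite sums of uniformly bounded real functions are uniformly bounded. [folklore] -/
theorem exists_bound_sum {ι X : Type*} (s : Finset ι) {f : ι → X → ℝ} (h : ∀ i ∈ s, ∃ C : ℝ, ∀ x, |f i x| ≤ C) :
    ∃ C : ℝ, ∀ x, |∑ i ∈ s, f i x| ≤ C := by
  classical
  choose! C hC using h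
  exact ⟨∑ i ∈ s, C i, fun x => (Finset.abs_sum_le_sum_abs _ _).trans (Finset.sum_le_sum fun i hi => hC i hi x)⟩

/-- A constant-guarded summand of a uniformly bounded function is uniformly bounded. [folklore] -/
theorem exists_bound_ite {X : Type*} (c : Prop) [Decidable c] {f : X → ℝ} (h : ∃ C : ℝ, ∀ x, |f x| ≤ C) :
    ∃ C : ℝ, ∀ x, |(if c then f x else 0)| ≤ C := by
  obtain ⟨C, hC⟩ := h
  refine ⟨C, fun x => ?_⟩
  by_cases hc : c
  · simp only [hc, if_true]; exact hC x
  · simp only [hc, if_false, abs_zero]; exact (abs_nonneg _).trans (hC x)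

/-- Sums of uniformly bounded functions are uniformly bounded. [folklore] -/
theorem exists_bound_add {X : Type*} {f g : X → ℝ} (hf : ∃ C : ℝ, ∀ x, |f x| ≤ C) (hg : ∃ C : ℝ, ∀ x, |g x| ≤ C) :
    ∃ C : ℝ, ∀ x, |f x + g x| ≤ C := by
  obtain ⟨Cf, hCf⟩ := hf
  obtain ⟨Cg, hCg⟩ := hg
  exact ⟨Cf + Cg, fun x => (abs_add_le _ _).trans (add_le_add (hCf x) (hCg x))⟩

/-- Differences of uniformly bounded functions are uniformly bounded. [folklore] -/
theorem exists_bound_sub {X : Type*} {f g : X → ℝ} (hf : ∃ C : ℝ, ∀ x, |f x| ≤ C) (hg : ∃ C : ℝ, ∀ x, |g x| ≤ C) :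
    ∃ C : ℝ, ∀ x, |f x - g x| ≤ C := by
  obtain ⟨Cf, hCf⟩ := hf
  obtain ⟨Cg, hCg⟩ := hg
  exact ⟨Cf + Cg, fun x => (abs_sub _ _).trans (add_le_add (hCf x) (hCg x))⟩

/-- Constant multiples of uniformly bounded functions are uniformly bounded. [folklore] -/
theorem exists_bound_const_mul {X : Type*} (c : ℝ) {f : X → ℝ} (hf : ∃ C : ℝ, ∀ x, |f x| ≤ C) : ∃ C : ℝ, ∀ x, |c * f x| ≤ C := by
  obtain ⟨Cf, hCf⟩ := hf
  exact ⟨|c| * Cf, fun x => by rw [abs_mul]; exact mul_le_mul_of_nonneg_left (hCf x) (abs_nonneg c)⟩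

/-- **`|A(w, U)| ≤ 2 Σ_p |w(p)|`** (`|Re tr| ≤ 1`, normalised trace). [cite: Balaban1988Convergent, (2.23) p.258 (bookkeeping)] -/
theorem abs_smearedWilson_le (K : ℕ) (w : Plaq (F.P K) 0 → ℝ) (U : GaugeField (F.P K) 0 (SU N)) :
    |smearedWilson w U| ≤ ∑ p : Plaq (F.P K) 0, |w p| * 2 := by
  unfold smearedWilson
  refine (Finset.abs_sum_le_sum_abs _ _).trans (Finset.sum_le_sum fun p _ => ?_)
  rw [abs_mul]
  refine mul_le_mul_of_nonneg_left ?_ (abs_nonneg _)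
  have h := RegularGaugeGroup.abs_reTr_le_one (G := SU N) (GaugeField.plaqHol U p)
  rw [abs_le] at h ⊢
  constructor <;> linarith [h.1, h.2]

variable {V : Type} {𝔸 : Type*} [NormedRing 𝔸] [NormedAlgebra ℂ 𝔸] [CompleteSpace 𝔸]

/-- **★ THE (2.23) ACTION OF RECORD IS BOUNDED ABOVE, uniformly in the `S`-data and the background field**, from uniform bounds on the three families of term
values read at the embedded background (E-row, R-row, B-row); the Wilson parts are bounded outright (`abs_smearedWilson_le`).
[cite: Balaban1988Convergent, (2.23)–(2.27) pp.258–259, (2.30)–(2.31) p.260, (2.40)–(2.41) p.261] -/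
theorem exists_bound_action23_of_termBounds (K : ℕ) (S : Sect2.Setting 𝔸 (SU N)) (Rz : Sect2.Residual (F.P K) 𝔸) (ν : Stage7Numerics) (M : ℕ) (g : ℕ → ℝ)
    (Ω Λ : ℕ → Set (Site (F.P K) 0)) (t : Sect2.TermValues (F.P K) 𝔸 V M) (k : ℕ) (Ek : ℝ)
    (hE : ∃ CE : ℝ, ∀ (j : ℕ) (X : (Sect2.domSys (F.P K) M j).Dom) (z : Site (F.P K) j) (g' : ℝ) (U : GaugeField (F.P K) 0 (SU N)),
      |(t.E j X z g' (Sect2.ofBackgroundC S.ι U)).re| ≤ CE)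
    (hR : ∃ CR : ℝ, ∀ (j : ℕ) (X : (Sect2.domSys (F.P K) M j).Dom) (U : GaugeField (F.P K) 0 (SU N)), |(t.R j X (Sect2.ofBackgroundC S.ι U)).re| ≤ CR)
    (hB : ∃ CB : ℝ, ∀ (j : ℕ) (X : (Sect2.domSys (F.P K) M j).Dom) (U : GaugeField (F.P K) 0 (SU N)) (a : Tk.SFluct (F.P K) V),
      |(t.B j X (Sect2.ofBackgroundC S.ι U) a).re| ≤ CB) :
    ∃ C : ℝ, ∀ (a : Tk.SFluct (F.P K) V) (U : GaugeField (F.P K) 0 (SU N)), (Sect2.actionDataOfTerms S Rz ν M g Ω Λ t k a Ek).action23 k U ≤ C := by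
  suffices h : ∃ C : ℝ, ∀ x : Tk.SFluct (F.P K) V × GaugeField (F.P K) 0 (SU N),
      |(Sect2.actionDataOfTerms S Rz ν M g Ω Λ t k x.1 Ek).action23 k x.2| ≤ C by
    obtain ⟨C, hC⟩ := h
    exact ⟨C, fun a U => (le_abs_self _).trans (hC (a, U))⟩
  simp only [Sect2.action23_actionDataOfTerms]
  obtain ⟨CE, hCE⟩ := hE
  obtain ⟨CR, hCR⟩ := hR
  obtain ⟨CB, hCB⟩ := hB
  refine exists_bound_sub (exists_bound_add (exists_bound_add (exists_bound_add ?_ ?_) ?_) ?_) ⟨|Ek|, fun _ => le_rfl⟩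
  · -- the local Wilson term
    exact ⟨_, fun x => by rw [abs_neg]; exact abs_smearedWilson_le (N := N) K _ x.2⟩
  · -- (2.25)
    unfold E225 EjSub
    refine exists_bound_sum _ fun j _ => exists_bound_sub ?_ (exists_bound_const_mul _ ⟨_, fun x => abs_smearedWilson_le (N := N) K _ x.2⟩)
    refine exists_bound_sum _ fun X _ => exists_bound_sum _ fun z _ => exists_bound_ite _ ?_
    exact exists_bound_sub ⟨CE, fun x => hCE j X z _ x.2⟩ ⟨CE, fun _ => hCE j X z _ 1⟩
  · -- (2.30)
    unfold R230
    refine exists_bound_sum _ fun j _ => exists_bound_sum _ fun X _ => exists_bound_ite _ ?_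
    exact exists_bound_sub ⟨CR, fun x => hCR j X x.2⟩ ⟨CR, fun _ => hCR j X 1⟩
  · -- (2.40)
    unfold B240
    refine exists_bound_sum _ fun j _ => exists_bound_sum _ fun X _ => exists_bound_ite _ ?_
    exact ⟨CB, fun x => hCB j X x.2 x.1⟩

/-- **★★ THE §2 OPERAND IS BOUNDED, uniformly in the `S`-data and the multiscale field**, from the three uniform term bounds: the «operand bounded» row of this seat's
specification `…N11NoExpansionStepSpecification` reduced to rows on the term values. [cite: Balaban1988Convergent, (2.18) p.257, (2.23)–(2.27) pp.258–259] -/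
theorem exists_bound_sect2Operand_of_termBounds (K : ℕ) (S : Sect2.Setting 𝔸 (SU N)) (Rz : Sect2.Residual (F.P K) 𝔸) {ν : Stage7Numerics} {M : ℕ} {g : ℕ → ℝ}
    {k : ℕ} (s : SeqOfRecord F ν M g K k) (t : Sect2.TermValues (F.P K) 𝔸 V M) (Ek : ℝ) (U : BgMap F N K)
    (hE : ∃ CE : ℝ, ∀ (j : ℕ) (X : (Sect2.domSys (F.P K) M j).Dom) (z : Site (F.P K) j) (g' : ℝ) (U : GaugeField (F.P K) 0 (SU N)),
      |(t.E j X z g' (Sect2.ofBackgroundC S.ι U)).re| ≤ CE)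
    (hR : ∃ CR : ℝ, ∀ (j : ℕ) (X : (Sect2.domSys (F.P K) M j).Dom) (U : GaugeField (F.P K) 0 (SU N)), |(t.R j X (Sect2.ofBackgroundC S.ι U)).re| ≤ CR)
    (hB : ∃ CB : ℝ, ∀ (j : ℕ) (X : (Sect2.domSys (F.P K) M j).Dom) (U : GaugeField (F.P K) 0 (SU N)) (a : Tk.SFluct (F.P K) V),
      |(t.B j X (Sect2.ofBackgroundC S.ι U) a).re| ≤ CB) :
    ∃ CΦ : ℝ, ∀ a W, sect2Operand F N V K S Rz s t Ek U a W ≤ CΦ := by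
  obtain ⟨C, hC⟩ := exists_bound_action23_of_termBounds (N := N) K S Rz ν M g s.Ω s.Λ t k Ek hE hR hB
  refine ⟨Real.exp C, fun a W => ?_⟩
  unfold sect2Operand sect2ActionDataOfRecord
  exact Real.exp_le_exp.2 (hC a (U W))

end Bound

end Summit.QuantumFields.YangMills.Theorems.BalabanUVNodesN11OperandRowsOfTermRows

end
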